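import Literature.NumberTheory.LFunctions.HardyZExtremaCriterionProofs
import Literature.NumberTheory.LFunctions.TuringMethod
import Mathlib.Analysis.Calculus.LocalExtr.Basic
import Mathlib.Analysis.Calculus.MeanValue
import HarnessLib

/-!
# stub_twoPoint — two-point sign change ⇒ Lehmer violation
-/

open Set Filter Topology
open Literature.NumberTheory.LFunctions

/-- `hardyZ` is continuous on any set. -/
private lemma hardyZ_continuousOn (s : Set ℝ) : ContinuousOn hardyZ s :=
  Continuous.continuousOn continuous_hardyZ

/-- `hardyZ` is differentiable (via `Ivic2003.hasDerivAt_hardyZ`). -/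
private lemma differentiable_hardyZ : Differentiable ℝ hardyZ := fun t =>
  (Ivic2003.hasDerivAt_hardyZ t).differentiableAt

/-- If `hardyZ` is non-zero on `[a,b]`, it has constant sign. -/
private lemma pos_or_neg_of_ne_zero {a b : ℝ} (hab : a < b)
    (hne : ∀ t ∈ Icc a b, hardyZ t ≠ 0) :
    (∀ t ∈ Icc a b, 0 < hardyZ t) ∨ (∀ t ∈ Icc a b, hardyZ t < 0) := by
  by_cases hpos : 0 < hardyZ a
  · left
    intro t ht
    by_contra hle
    push Not at hle
    have hmem : (0 : ℝ) ∈ Icc (hardyZ t) (hardyZ a) := ⟨hle, hpos.le⟩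
    have hIcc : Icc a t ⊆ Icc a b := Icc_subset_Icc le_rfl ht.2
    have := intermediate_value_Icc' ht.1 (hardyZ_continuousOn _ |>.mono hIcc) hmem
    obtain ⟨c, hc, hc0⟩ := this
    exact hne c (hIcc hc) hc0
  · push Not at hpos
    have hne_a := hne a (left_mem_Icc.mpr hab.le)
    have ha_neg : hardyZ a < 0 := lt_of_le_of_ne hpos hne_a
    right
    intro t ht
    by_contra hge
    push Not at hge
    have hmem : (0 : ℝ) ∈ Icc (hardyZ a) (hardyZ t) := ⟨ha_neg.le, hge⟩
    have hIcc : Icc a t ⊆ Icc a b := Icc_subset_Icc le_rfl ht.2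
    have := intermediate_value_Icc ht.1 (hardyZ_continuousOn _ |>.mono hIcc) hmem
    obtain ⟨c, hc, hc0⟩ := this
    exact hne c (hIcc hc) hc0

/-- `hardyZ` attains its minimum on `[a,b]`. -/
private lemma exists_min_on_Icc {a b : ℝ} (hab : a ≤ b) :
    ∃ t ∈ Icc a b, ∀ s ∈ Icc a b, hardyZ t ≤ hardyZ s :=
  IsCompact.exists_isMinOn isCompact_Icc (nonempty_Icc.mpr hab) (hardyZ_continuousOn _)

/-- `hardyZ` attains its maximum on `[a,b]`. -/
private lemma exists_max_on_Icc {a b : ℝ} (hab : a ≤ b) :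
    ∃ t ∈ Icc a b, ∀ s ∈ Icc a b, hardyZ s ≤ hardyZ t :=
  IsCompact.exists_isMaxOn isCompact_Icc (nonempty_Icc.mpr hab) (hardyZ_continuousOn _)

/-- If `f` has negative derivative at `a`, then `f(x) < f(a)` for some `x` in `(a, c)`. -/
private lemma lt_of_hasDerivAt_neg {f : ℝ → ℝ} {a f' : ℝ} (hf : HasDerivAt f f' a)
    (hf'_neg : f' < 0) {c : ℝ} (hc : a < c) : ∃ x ∈ Ioo a c, f x < f a := by
  have hε : 0 < -f' / 2 := by linarith
  rw [hasDerivAt_iff_tendsto_slope] at hf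
  rw [Metric.tendsto_nhdsWithin_nhds] at hf
  obtain ⟨δ, hδpos, hδ⟩ := hf (-f' / 2) hε
  set k := min (δ / 2) ((c - a) / 2) with hk_def
  have hk_pos : 0 < k := lt_min (by linarith) (by linarith)
  have hk_lt_δ : k < δ := lt_of_le_of_lt (min_le_left _ _) (by linarith : δ / 2 < δ)
  have hne : a + k ≠ a := by linarith
  have hmem : a + k ∈ ({a} : Set ℝ)ᶜ := mem_compl_singleton_iff.mpr hne
  have hdist : dist (a + k) a < δ := by simp [abs_of_pos hk_pos, hk_lt_δ]
  have hslope_bound := hδ hmem hdist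
  rw [Real.dist_eq] at hslope_bound
  have hslope_neg : slope f a (a + k) < 0 := by
    have := abs_lt.mp hslope_bound
    linarith
  have hf_lt : f (a + k) < f a := by
    rw [slope_def_field] at hslope_neg
    simp only [add_sub_cancel_left] at hslope_neg
    have h1 : (f (a + k) - f a) / k < 0 := hslope_neg
    have h2 : f (a + k) - f a < 0 * k := (div_lt_iff₀ hk_pos).mp h1
    have h3 : (0 : ℝ) * k = 0 := by ring
    linarith
  refine ⟨a + k, ⟨by linarith, ?_⟩, hf_lt⟩
  have : k ≤ (c - a) / 2 := min_le_right _ _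
  linarith

/-- If `f` has positive derivative at `b`, then `f(x) < f(b)` for some `x` in `(a, b)`. -/
private lemma lt_of_hasDerivAt_pos {f : ℝ → ℝ} {b f' : ℝ} (hf : HasDerivAt f f' b)
    (hf'_pos : 0 < f') {a : ℝ} (ha : a < b) : ∃ x ∈ Ioo a b, f x < f b := by
  have hε : 0 < f' / 2 := by linarith
  rw [hasDerivAt_iff_tendsto_slope] at hf
  rw [Metric.tendsto_nhdsWithin_nhds] at hf
  obtain ⟨δ, hδpos, hδ⟩ := hf (f' / 2) hε
  set k := min (δ / 2) ((b - a) / 2) with hk_def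
  have hk_pos : 0 < k := lt_min (by linarith) (by linarith)
  have hk_lt_δ : k < δ := lt_of_le_of_lt (min_le_left _ _) (by linarith : δ / 2 < δ)
  have hne : b - k ≠ b := by linarith
  have hmem : b - k ∈ ({b} : Set ℝ)ᶜ := mem_compl_singleton_iff.mpr hne
  have hdist : dist (b - k) b < δ := by simp [abs_of_pos hk_pos, hk_lt_δ]
  have hslope_bound := hδ hmem hdist
  rw [Real.dist_eq] at hslope_bound
  have hslope_pos : 0 < slope f b (b - k) := by
    have := abs_lt.mp hslope_bound
    linarith
  have hf_lt : f (b - k) < f b := by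
    rw [slope_def_field] at hslope_pos
    -- (b - k) - b = -k, so slope = (f (b - k) - f b) / (-k)
    have heq : (b - k) - b = -k := by ring
    rw [heq] at hslope_pos
    have hk_neg : -k < 0 := by linarith
    have h1 : 0 < (f (b - k) - f b) / (-k) := hslope_pos
    rw [div_pos_iff] at h1
    rcases h1 with ⟨hnum, hdenom⟩ | ⟨hnum, hdenom⟩
    · -- f (b - k) - f b > 0 and -k > 0, but -k < 0, contradiction
      linarith
    · -- f (b - k) - f b < 0 and -k < 0
      linarith
  refine ⟨b - k, ⟨?_, by linarith⟩, hf_lt⟩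
  have : k ≤ (b - a) / 2 := min_le_right _ _
  linarith

/-- If f' > 0 at a, there exists x > a with f(x) > f(a). -/
private lemma gt_of_hasDerivAt_pos_right {f : ℝ → ℝ} {a f' : ℝ} (hf : HasDerivAt f f' a)
    (hf'_pos : 0 < f') {c : ℝ} (hc : a < c) : ∃ x ∈ Ioo a c, f a < f x := by
  have hε : 0 < f' / 2 := by linarith
  rw [hasDerivAt_iff_tendsto_slope] at hf
  rw [Metric.tendsto_nhdsWithin_nhds] at hf
  obtain ⟨δ, hδpos, hδ⟩ := hf (f' / 2) hε
  set k := min (δ / 2) ((c - a) / 2) with hk_def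
  have hk_pos : 0 < k := lt_min (by linarith) (by linarith)
  have hk_lt_δ : k < δ := lt_of_le_of_lt (min_le_left _ _) (by linarith : δ / 2 < δ)
  have hne : a + k ≠ a := by linarith
  have hmem : a + k ∈ ({a} : Set ℝ)ᶜ := mem_compl_singleton_iff.mpr hne
  have hdist : dist (a + k) a < δ := by simp [abs_of_pos hk_pos, hk_lt_δ]
  have hslope_bound := hδ hmem hdist
  rw [Real.dist_eq] at hslope_bound
  have hslope_pos : 0 < slope f a (a + k) := by
    have := abs_lt.mp hslope_bound
    linarith
  have hf_gt : f a < f (a + k) := by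
    rw [slope_def_field] at hslope_pos
    simp only [add_sub_cancel_left] at hslope_pos
    have h1 : 0 < (f (a + k) - f a) / k := hslope_pos
    have h2 : 0 * k < f (a + k) - f a := (lt_div_iff₀ hk_pos).mp h1
    have h3 : (0 : ℝ) * k = 0 := by ring
    linarith
  refine ⟨a + k, ⟨by linarith, ?_⟩, hf_gt⟩
  have : k ≤ (c - a) / 2 := min_le_right _ _
  linarith

/-- If f' < 0 at b, there exists x < b with f(x) > f(b). -/
private lemma gt_of_hasDerivAt_neg_left {f : ℝ → ℝ} {b f' : ℝ} (hf : HasDerivAt f f' b)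
    (hf'_neg : f' < 0) {a : ℝ} (ha : a < b) : ∃ x ∈ Ioo a b, f b < f x := by
  have hε : 0 < -f' / 2 := by linarith
  rw [hasDerivAt_iff_tendsto_slope] at hf
  rw [Metric.tendsto_nhdsWithin_nhds] at hf
  obtain ⟨δ, hδpos, hδ⟩ := hf (-f' / 2) hε
  set k := min (δ / 2) ((b - a) / 2) with hk_def
  have hk_pos : 0 < k := lt_min (by linarith) (by linarith)
  have hk_lt_δ : k < δ := lt_of_le_of_lt (min_le_left _ _) (by linarith : δ / 2 < δ)
  have hne : b - k ≠ b := by linarith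
  have hmem : b - k ∈ ({b} : Set ℝ)ᶜ := mem_compl_singleton_iff.mpr hne
  have hdist : dist (b - k) b < δ := by simp [abs_of_pos hk_pos, hk_lt_δ]
  have hslope_bound := hδ hmem hdist
  rw [Real.dist_eq] at hslope_bound
  have hslope_neg : slope f b (b - k) < 0 := by
    have := abs_lt.mp hslope_bound
    linarith
  have hf_gt : f b < f (b - k) := by
    rw [slope_def_field] at hslope_neg
    have heq : (b - k) - b = -k := by ring
    rw [heq] at hslope_neg
    have hk_neg : -k < 0 := by linarith
    have h1 : (f (b - k) - f b) / (-k) < 0 := hslope_neg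
    rw [div_neg_iff] at h1
    rcases h1 with ⟨hnum, hdenom⟩ | ⟨hnum, hdenom⟩
    · -- f (b - k) - f b > 0 and -k < 0
      linarith
    · -- f (b - k) - f b < 0 and -k > 0, but -k < 0, contradiction
      linarith
  refine ⟨b - k, ⟨?_, by linarith⟩, hf_gt⟩
  have : k ≤ (b - a) / 2 := min_le_right _ _
  linarith

/-- **stub_twoPoint (stub E)**: if `Z ≠ 0` on `[a,b]` and `Z'/Z` changes sign from negative to positive
across `[a,b]`, then `Z` has a positive local minimum or a negative local maximum in `(a,b)`.
By IVT `Z` has constant sign; the extreme value theorem gives a global extremum on `[a,b]`; the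
derivative sign conditions exclude the boundary. Port of C1² S3 `stub_signChangeViolation`. -/
theorem stub_twoPoint :
    ∀ a b : ℝ, a < b → (∀ t ∈ Set.Icc a b, hardyZ t ≠ 0) →
      deriv hardyZ a / hardyZ a < 0 → 0 < deriv hardyZ b / hardyZ b →
        ∃ t ∈ Set.Ioo a b,
          (IsLocalMin hardyZ t ∧ 0 < hardyZ t) ∨ (IsLocalMax hardyZ t ∧ hardyZ t < 0) := by
  intro a b hab hne hdiva hdivb
  rcases pos_or_neg_of_ne_zero hab hne with hpos | hneg
  -- Case 1: Z > 0 on [a,b]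
  · have hZa_pos : 0 < hardyZ a := hpos a (left_mem_Icc.mpr hab.le)
    have hZb_pos : 0 < hardyZ b := hpos b (right_mem_Icc.mpr hab.le)
    have hZ'a_neg : deriv hardyZ a < 0 := by
      rcases div_neg_iff.mp hdiva with ⟨_, h2⟩ | ⟨h1, _⟩
      · exact absurd hZa_pos (not_lt.mpr h2.le)
      · exact h1
    have hZ'b_pos : 0 < deriv hardyZ b := by
      rcases div_pos_iff.mp hdivb with ⟨h1, _⟩ | ⟨_, h2⟩
      · exact h1
      · exact absurd hZb_pos (not_lt.mpr h2.le)
    obtain ⟨t, ht, hmin⟩ := exists_min_on_Icc hab.le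
    -- t ≠ a: Z'(a) < 0 means there exists x > a with Z(x) < Z(a)
    have hne_a : t ≠ a := by
      intro heq
      obtain ⟨x, hx, hfx⟩ := lt_of_hasDerivAt_neg (differentiable_hardyZ a).hasDerivAt hZ'a_neg hab
      have hxIcc : x ∈ Icc a b := ⟨hx.1.le, hx.2.le⟩
      have := hmin x hxIcc
      rw [heq] at this
      linarith
    -- t ≠ b: Z'(b) > 0 means there exists x < b with Z(x) < Z(b)
    have hne_b : t ≠ b := by
      intro heq
      obtain ⟨x, hx, hfx⟩ := lt_of_hasDerivAt_pos (differentiable_hardyZ b).hasDerivAt hZ'b_pos hab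
      have hxIcc : x ∈ Icc a b := ⟨hx.1.le, hx.2.le⟩
      have := hmin x hxIcc
      rw [heq] at this
      linarith
    have ht_int : t ∈ Ioo a b := ⟨lt_of_le_of_ne ht.1 (Ne.symm hne_a), lt_of_le_of_ne ht.2 hne_b⟩
    refine ⟨t, ht_int, Or.inl ⟨?_, hpos t ht⟩⟩
    exact IsMinOn.isLocalMin (fun x hx => hmin x hx) (Icc_mem_nhds ht_int.1 ht_int.2)
  -- Case 2: Z < 0 on [a,b] — need local max
  · have hZa_neg : hardyZ a < 0 := hneg a (left_mem_Icc.mpr hab.le)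
    have hZb_neg : hardyZ b < 0 := hneg b (right_mem_Icc.mpr hab.le)
    have hZ'a_pos : 0 < deriv hardyZ a := by
      rcases div_neg_iff.mp hdiva with ⟨h1, _⟩ | ⟨_, h2⟩
      · exact h1
      · exact absurd hZa_neg (not_lt.mpr h2.le)
    have hZ'b_neg : deriv hardyZ b < 0 := by
      rcases div_pos_iff.mp hdivb with ⟨_, h2⟩ | ⟨h1, _⟩
      · exact absurd hZb_neg (not_lt.mpr h2.le)
      · exact h1
    obtain ⟨t, ht, hmax⟩ := exists_max_on_Icc hab.le
    -- t ≠ a: Z'(a) > 0 means there exists x > a with Z(x) > Z(a)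
    have hne_a : t ≠ a := by
      intro heq
      obtain ⟨x, hx, hfx⟩ := gt_of_hasDerivAt_pos_right (differentiable_hardyZ a).hasDerivAt hZ'a_pos hab
      have hxIcc : x ∈ Icc a b := ⟨hx.1.le, hx.2.le⟩
      have := hmax x hxIcc
      rw [heq] at this
      linarith
    -- t ≠ b: Z'(b) < 0 means there exists x < b with Z(x) > Z(b)
    have hne_b : t ≠ b := by
      intro heq
      obtain ⟨x, hx, hfx⟩ := gt_of_hasDerivAt_neg_left (differentiable_hardyZ b).hasDerivAt hZ'b_neg hab
      have hxIcc : x ∈ Icc a b := ⟨hx.1.le, hx.2.le⟩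
      have := hmax x hxIcc
      rw [heq] at this
      linarith
    have ht_int : t ∈ Ioo a b := ⟨lt_of_le_of_ne ht.1 (Ne.symm hne_a), lt_of_le_of_ne ht.2 hne_b⟩
    refine ⟨t, ht_int, Or.inr ⟨?_, hneg t ht⟩⟩
    exact IsMaxOn.isLocalMax (fun x hx => hmax x hx) (Icc_mem_nhds ht_int.1 ht_int.2)
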